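import Mathlib
import HarnessLib
import Summits.ValiantsHypothesis.ValiantsHypothesis.Theorems.MonotoneRestorationOrbitRestorationQPSimpleGraphCutThreshold
import Summits.ValiantsHypothesis.ValiantsHypothesis.Theorems.MonotoneRestorationMonotoneRestorationQPSimpleGraphCut

/-!
# Route MonotoneRestoration — the two simple-graph cuts COMPARED: modulo "no arithmetic CFI" the monotone SIZE half is
# the ORBIT half plus compression (items 18293 / 15886 / 16191 / 18332 by name)

Helper file (`--supports`), def-free; ties `SimpleGraphCut.orbitRestorationQP_iff_cut_witness` (p825944: L1 ⟺ W₁ ∧ ¬PolylogWidthVP)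
to `SimpleGraphCut.monotoneRestorationQP_iff_cut_witness` (p825855: crux 15886 ⟺ Wᵐ ∧ ¬PolylogWidthMonotoneEasy) through the
certified orbit cut `MonotoneRestorationQP ⟺ OrbitRestorationQP ∧ OrbitCompressionQP` (p823507):

* `not_polylogWidthMonotoneEasy_of_not_polylogWidthVP` — H₁ ⇒ Hᵐ (the monotone kill witness complexifies to a VP one,
  `polylogWidthVP_of_polylogWidthMonotoneEasy`);
* `monotoneW_iff_orbitW_and_compression` — **under H₁ (= `¬ PolylogWidthVP`): Wᵐ ⟺ W₁ ∧ OrbitCompressionQP** — the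
  monotone size-currency circuit half of 15886/16191 is EXACTLY the orbit-currency circuit half of 18293 plus the aside
  18332;
* `monotoneRestorationQP_iff_orbitW_compression_witness` — hence, unconditionally,
  `MonotoneRestorationQP ⟺ (W₁ ∧ OrbitCompressionQP) ∧ ¬ PolylogWidthVP`, and the same for `NonnegRestorationQP`.

Honest label: by-name glue; nothing closed; VP ≠ VNP NOT moved. [folklore]
-/

-- `Summit.ValiantsHypothesis.ValiantsHypothesis.…` is the tree's mandated namespace (Sub = Summit).
set_option linter.dupNamespace false

noncomputable section

namespace Summit.ValiantsHypothesis.ValiantsHypothesis.Theorems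

namespace SimpleGraphCut

open Summit.ValiantsHypothesis.ValiantsHypothesis.Theses.MonotoneRestoration
open Literature.Computability.AlgebraicComplexity
open Literature.ModelTheory.FiniteModelTheory
open MonotoneRestorationQPLinearWidth
open MvPolynomial

/-- **H₁ ⇒ Hᵐ**: if no matrix-symmetric `VP` family is polylog-separating then no monotone-easy one is
(`polylogWidthVP_of_polylogWidthMonotoneEasy`, contrapositively). [folklore] -/
theorem not_polylogWidthMonotoneEasy_of_not_polylogWidthVP (h : ¬ PolylogWidthVP) : ¬ PolylogWidthMonotoneEasy :=
  fun hm => h (polylogWidthVP_of_polylogWidthMonotoneEasy hm)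

/-- **Under H₁, Wᵐ ⟺ W₁ ∧ OrbitCompressionQP.**  Modulo "no arithmetic CFI for matrix-symmetric `VP` families", the
monotone size-currency circuit half (of `monotoneRestorationQP_iff_simpleGraphCut`) is exactly the orbit-currency circuit
half (of `orbitRestorationQP_iff_simpleGraphCut`) together with orbit-to-size compression (stmt-18332). [folklore] -/
theorem monotoneW_iff_orbitW_and_compression (hH : ¬ PolylogWidthVP) :
    (∀ f : (n : ℕ) → MvPolynomial (Fin n × Fin n) NNReal,
        (∀ (n : ℕ) (σ τ : Equiv.Perm (Fin n)),
          MvPolynomial.rename (fun p : Fin n × Fin n => (σ p.1, τ p.2)) (f n) = f n) →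
        (∃ c : ℕ, ∀ n : ℕ, (f n).totalDegree ≤ (n + 2) ^ c ∧ complexity (k := NNReal) (f n) ≤ (n + 2) ^ c) →
        (∃ c N : ℕ, ∀ m : ℕ, N ≤ m → ∀ X Y : SimpleGraph (Fin m), CkEquiv ((Nat.log 2 m + c) ^ c) X Y →
          MvPolynomial.eval (Set.indicator {ij : Fin m × Fin m | X.Adj ij.1 ij.2} 1)
              (MvPolynomial.map (Complex.ofRealHom.comp NNReal.toRealHom) (f m)) =
            MvPolynomial.eval (Set.indicator {ij : Fin m × Fin m | Y.Adj ij.1 ij.2} 1)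
              (MvPolynomial.map (Complex.ofRealHom.comp NNReal.toRealHom) (f m))) →
        ∃ c : ℕ, ∀ n : ℕ, ∃ (G : Type) (_ : Fintype G)
          (C : LabelledArithCircuit ℂ (Fin n × Fin n) Unit G),
          C.IsSymmetric (Equiv.Perm (Fin n)) ∧
            C.eval (C.output ()) = MvPolynomial.map (Complex.ofRealHom.comp NNReal.toRealHom) (f n) ∧
              Fintype.card G ≤ 2 ^ ((Nat.log 2 n + c) ^ c)) ↔
      ((∀ f : (n : ℕ) → MvPolynomial (Fin n × Fin n) ℂ, IsMatrixSymmetric f → IsVPFamily f →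
          (∃ c N : ℕ, ∀ m : ℕ, N ≤ m → ∀ X Y : SimpleGraph (Fin m),
            CkEquiv ((Nat.log 2 m + c) ^ c) X Y →
              MvPolynomial.eval (Set.indicator {ij : Fin m × Fin m | X.Adj ij.1 ij.2} 1) (f m) =
                MvPolynomial.eval (Set.indicator {ij : Fin m × Fin m | Y.Adj ij.1 ij.2} 1) (f m)) →
          QPOrbitSymm f) ∧
        OrbitCompressionQP) := by
  constructor
  · intro hWm
    have hcrux : MonotoneRestorationQP :=
      monotoneRestorationQP_iff_cut_witness.mpr ⟨hWm, not_polylogWidthMonotoneEasy_of_not_polylogWidthVP hH⟩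
    exact ⟨(orbitRestorationQP_iff_cut_witness.mp
        (MonotoneRestorationQPOrbitCut.orbitRestorationQP_of_monotoneRestorationQP hcrux)).1,
      MonotoneRestorationQPOrbitCut.orbitCompressionQP_of_monotoneRestorationQP hcrux⟩
  · rintro ⟨hW1, hL2⟩
    have hL1 : OrbitRestorationQP := orbitRestorationQP_iff_cut_witness.mpr ⟨hW1, hH⟩
    have hcrux : MonotoneRestorationQP :=
      MonotoneRestorationQPOrbitCut.monotoneRestorationQP_iff_orbitCut.mpr ⟨hL1, hL2⟩
    exact (monotoneRestorationQP_iff_cut_witness.mp hcrux).1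

/-- **`MonotoneRestorationQP ⟺ (W₁ ∧ OrbitCompressionQP) ∧ ¬ PolylogWidthVP`** — the monotone crux (stmt-15886) in the
orbit currency of stmt-18293 plus the aside stmt-18332 plus the non-existence of a polylog-width `VP` family. [folklore] -/
theorem monotoneRestorationQP_iff_orbitW_compression_witness :
    MonotoneRestorationQP ↔
      (((∀ f : (n : ℕ) → MvPolynomial (Fin n × Fin n) ℂ, IsMatrixSymmetric f → IsVPFamily f →
          (∃ c N : ℕ, ∀ m : ℕ, N ≤ m → ∀ X Y : SimpleGraph (Fin m),
            CkEquiv ((Nat.log 2 m + c) ^ c) X Y →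
              MvPolynomial.eval (Set.indicator {ij : Fin m × Fin m | X.Adj ij.1 ij.2} 1) (f m) =
                MvPolynomial.eval (Set.indicator {ij : Fin m × Fin m | Y.Adj ij.1 ij.2} 1) (f m)) →
          QPOrbitSymm f) ∧
        OrbitCompressionQP) ∧ ¬ PolylogWidthVP) := by
  rw [MonotoneRestorationQPOrbitCut.monotoneRestorationQP_iff_orbitCut, orbitRestorationQP_iff_cut_witness]
  tauto

/-- The same for the target `NonnegRestorationQP` (stmt-16191), through `monotoneRestorationQP_iff_nonnegRestorationQP`. [folklore] -/
theorem nonnegRestorationQP_iff_orbitW_compression_witness :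
    NonnegRestorationQP ↔
      (((∀ f : (n : ℕ) → MvPolynomial (Fin n × Fin n) ℂ, IsMatrixSymmetric f → IsVPFamily f →
          (∃ c N : ℕ, ∀ m : ℕ, N ≤ m → ∀ X Y : SimpleGraph (Fin m),
            CkEquiv ((Nat.log 2 m + c) ^ c) X Y →
              MvPolynomial.eval (Set.indicator {ij : Fin m × Fin m | X.Adj ij.1 ij.2} 1) (f m) =
                MvPolynomial.eval (Set.indicator {ij : Fin m × Fin m | Y.Adj ij.1 ij.2} 1) (f m)) →
          QPOrbitSymm f) ∧
        OrbitCompressionQP) ∧ ¬ PolylogWidthVP) := by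
  rw [← MonotoneRestorationQPOrbitCut.monotoneRestorationQP_iff_nonnegRestorationQP]
  exact monotoneRestorationQP_iff_orbitW_compression_witness

end SimpleGraphCut

end Summit.ValiantsHypothesis.ValiantsHypothesis.Theorems

end
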